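import Summits.Ventures.PackingBounds.Configurations.LeechVectors

/-!
# The `196560` minimal vectors of the Leech lattice: the finite set and its cardinality

Framing: lottery ticket; floor = certified bounds/negative ranges. Venture `PackingBounds` (cell
`pub-packcert`, seat `pub-packcert-energy`), attained side of `κ(24) = 196560`.

`leechInt : Finset (Fin 24 → ℤ)` is the union of the three shape families of
`Configurations/LeechVectors.lean` (indices: `k < l` and two sign bits; an octad `o : Fin 759` and a sign
pattern `v < 128`; a coordinate `i : Fin 24` and a Golay message `u < 4096`). The three parametrisations
are injective and the three families are disjoint (coordinates `≡ 0 mod 4` / `±2` on an octad / odd), so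
`leechInt.card = 1104 + 97152 + 98304 = 196560` (`card_leechInt`) — a structural count, no enumeration.
Every member has `ip x x = 32` and two distinct members have `ip x y ≤ 16` (`ip_self_of_mem`,
`ip_le_of_mem`).

## References
* J. H. Conway, N. J. A. Sloane, *Sphere Packings, Lattices and Groups*, Ch. 4 §11. [`ConwaySloane1999`]
-/

namespace Summit.Ventures.PackingBounds.Config.Leech

open Finset Golay

/-! ### The three index sets and the configuration -/

/-- Indices of shape `A`: coordinate pairs `k < l` and two sign bits. -/
def idxA : Finset ((Fin 24 × Fin 24) × (Bool × Bool)) :=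
  ((univ ×ˢ univ).filter fun kl : Fin 24 × Fin 24 => kl.1 < kl.2) ×ˢ univ

/-- Indices of shape `B`: an octad and a `7`-bit sign pattern. -/
def idxB : Finset (Fin 759 × ℕ) := univ ×ˢ range 128

/-- Indices of shape `C`: a coordinate and a `12`-bit Golay message. -/
def idxC : Finset (Fin 24 × ℕ) := univ ×ˢ range 4096

/-- Shape-`A` vectors. -/
def setA : Finset (Fin 24 → ℤ) := idxA.image fun p => avec p.1.1 p.1.2 p.2.1 p.2.2

/-- Shape-`B` vectors. -/
def setB : Finset (Fin 24 → ℤ) := idxB.image fun p => bvec p.1 p.2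

/-- Shape-`C` vectors. -/
def setC : Finset (Fin 24 → ℤ) := idxC.image fun p => cvec p.1 p.2

/-- **The `196560` minimal vectors of `√8 · Λ₂₄`** as integer vectors of norm `32`.
[cite: ConwaySloane1999, Ch. 4 §11 (135)] -/
def leechInt : Finset (Fin 24 → ℤ) := setA ∪ setB ∪ setC

-- The sets are used through their membership / cardinality lemmas only; keeping them irreducible stops
-- `whnf` from evaluating the (large) underlying multisets during elaboration.
attribute [irreducible] idxA idxB idxC setA setB setC leechInt

/-- `|idxA| = 4 · C(24, 2) = 1104`. -/
theorem card_idxA : idxA.card = 1104 := by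
  rw [idxA, card_product]
  decide +kernel

/-- `|idxB| = 759 · 128 = 97152`. -/
theorem card_idxB : idxB.card = 97152 := by
  simp [idxB, card_product]

/-- `|idxC| = 24 · 4096 = 98304`. -/
theorem card_idxC : idxC.card = 98304 := by
  simp [idxC, card_product]

/-! ### Injectivity of the three parametrisations -/

/-- Support of a shape-`A` vector. -/
theorem avec_ne_zero_iff {k l : Fin 24} (hkl : k < l) (a b : Bool) (j : Fin 24) :
    avec k l a b j ≠ 0 ↔ j = k ∨ j = l := by
  have hne : k ≠ l := ne_of_lt hkl
  unfold avec
  rcases sgn_cases a with ha | ha <;> rcases sgn_cases b with hb | hb <;> rw [ha, hb] <;>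
    by_cases hk : j = k <;> by_cases hl : j = l <;> simp [hk, hl] <;> omega

/-- Value of a shape-`A` vector at its first coordinate. -/
theorem avec_apply_left {k l : Fin 24} (hkl : k < l) (a b : Bool) : avec k l a b k = 4 * sgn a := by
  simp [avec, ne_of_lt hkl]

/-- Value of a shape-`A` vector at its second coordinate. -/
theorem avec_apply_right {k l : Fin 24} (hkl : k < l) (a b : Bool) : avec k l a b l = 4 * sgn b := by
  simp [avec, (ne_of_lt hkl).symm]

/-- The shape-`A` parametrisation is injective. -/
theorem avec_inj {k l k' l' : Fin 24} (hkl : k < l) (hkl' : k' < l') {a b a' b' : Bool}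
    (h : avec k l a b = avec k' l' a' b') : k = k' ∧ l = l' ∧ a = a' ∧ b = b' := by
  have hs : ∀ j, (j = k ∨ j = l) ↔ (j = k' ∨ j = l') := fun j => by
    rw [← avec_ne_zero_iff hkl a b, ← avec_ne_zero_iff hkl' a' b', h]
  have h1 := hs k; have h2 := hs l; have h3 := hs k'; have h4 := hs l'
  have hk : k = k' := by omega
  have hl : l = l' := by omega
  subst hk hl
  have ea := congrFun h k; have eb := congrFun h l
  rw [avec_apply_left hkl, avec_apply_left hkl'] at ea
  rw [avec_apply_right hkl, avec_apply_right hkl'] at eb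
  exact ⟨rfl, rfl, sgn_injective (by omega), sgn_injective (by omega)⟩

/-- The shape-`C` parametrisation is injective. -/
theorem cvec_inj {i i' : Fin 24} {u u' : ℕ} (hu : u < 4096) (hu' : u' < 4096)
    (h : cvec i u = cvec i' u') : i = i' ∧ u = u' := by
  have hii : i = i' := by
    by_contra hii
    have e := congrFun h i
    rcases cvec_apply_cases i u i with ⟨hne, _⟩ | ⟨_, h3 | h3⟩
    · exact hne rfl
    all_goals
      rcases cvec_apply_cases i' u' i with ⟨_, h1 | h1⟩ | ⟨heq, _⟩ <;> omega
  subst hii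
  refine ⟨rfl, cw_injective hu hu' (eq_of_supp_eq (cw_sys u hu).2 (cw_sys u' hu').2 ?_)⟩
  ext j
  have e := congrFun h j
  simp only [cvec] at e
  have hf : (if j = i then (-3 : ℤ) else 1) ≠ 0 := by split_ifs <;> norm_num
  have hs := sgn_injective (mul_right_cancel₀ hf e)
  simp only [mem_supp, hs]

/-- Support of a shape-`B` vector. -/
theorem bvec_ne_zero_iff (o : Fin 759) (v : ℕ) (j : Fin 24) : bvec o v j ≠ 0 ↔ j ∈ osupp o := by
  rcases bvec_apply_cases o v j with ⟨h0, h1⟩ | ⟨h0, h1 | h1⟩ <;> simp [h0, h1]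

/-- The shape-`B` parametrisation is injective. -/
theorem bvec_inj {o o' : Fin 759} {v v' : ℕ} (hv : v < 128) (hv' : v' < 128)
    (h : bvec o v = bvec o' v') : o = o' ∧ v = v' := by
  have hoo : o = o' := by
    apply osupp_injective
    ext j
    rw [← bvec_ne_zero_iff o v j, ← bvec_ne_zero_iff o' v' j, h]
  subst hoo
  refine ⟨rfl, ?_⟩
  by_contra hvv
  obtain ⟨r, hr⟩ := bbit_ne_of_ne hv hv' hvv
  apply hr
  have e := congrFun h (opos o r)
  rw [bvec_apply_opos, bvec_apply_opos] at e
  exact sgn_injective (by omega)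

/-- `|A| = 1104`. -/
theorem card_setA : setA.card = 1104 := by
  rw [setA, card_image_of_injOn, card_idxA]
  rintro ⟨⟨k, l⟩, ⟨a, b⟩⟩ hp ⟨⟨k', l'⟩, ⟨a', b'⟩⟩ hp' h
  have hkl : k < l := by simpa [idxA] using hp
  have hkl' : k' < l' := by simpa [idxA] using hp'
  obtain ⟨e1, e2, e3, e4⟩ := avec_inj hkl hkl' h
  subst e1 e2 e3 e4; rfl

/-- `|B| = 97152`. -/
theorem card_setB : setB.card = 97152 := by
  rw [setB, card_image_of_injOn, card_idxB]
  rintro ⟨o, v⟩ hp ⟨o', v'⟩ hp' h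
  have hv : v < 128 := by simpa [idxB] using hp
  have hv' : v' < 128 := by simpa [idxB] using hp'
  obtain ⟨e1, e2⟩ := bvec_inj hv hv' h
  subst e1 e2; rfl

/-- `|C| = 98304`. -/
theorem card_setC : setC.card = 98304 := by
  rw [setC, card_image_of_injOn, card_idxC]
  rintro ⟨i, u⟩ hp ⟨i', u'⟩ hp' h
  have hu : u < 4096 := by simpa [idxC] using hp
  have hu' : u' < 4096 := by simpa [idxC] using hp'
  obtain ⟨e1, e2⟩ := cvec_inj hu hu' h
  subst e1 e2; rfl

/-! ### Membership, disjointness, cardinality -/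

/-- Members of `A`. -/
theorem mem_setA {x : Fin 24 → ℤ} : x ∈ setA ↔ ∃ k l : Fin 24, ∃ a b : Bool, k < l ∧ x = avec k l a b := by
  simp only [setA, idxA, mem_image, mem_product, mem_filter, mem_univ, true_and, and_true, Prod.exists]
  constructor
  · rintro ⟨k, l, a, b, hkl, rfl⟩; exact ⟨k, l, a, b, hkl, rfl⟩
  · rintro ⟨k, l, a, b, hkl, rfl⟩; exact ⟨k, l, a, b, hkl, rfl⟩

/-- Members of `B`. -/
theorem mem_setB {x : Fin 24 → ℤ} : x ∈ setB ↔ ∃ o : Fin 759, ∃ v < 128, x = bvec o v := by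
  simp only [setB, idxB, mem_image, mem_product, mem_univ, mem_range, true_and, Prod.exists]
  constructor
  · rintro ⟨o, v, hv, rfl⟩; exact ⟨o, v, hv, rfl⟩
  · rintro ⟨o, v, hv, rfl⟩; exact ⟨o, v, hv, rfl⟩

/-- Members of `C`. -/
theorem mem_setC {x : Fin 24 → ℤ} : x ∈ setC ↔ ∃ i : Fin 24, ∃ u < 4096, x = cvec i u := by
  simp only [setC, idxC, mem_image, mem_product, mem_univ, mem_range, true_and, Prod.exists]
  constructor
  · rintro ⟨i, u, hu, rfl⟩; exact ⟨i, u, hu, rfl⟩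
  · rintro ⟨i, u, hu, rfl⟩; exact ⟨i, u, hu, rfl⟩

/-- `A` and `B` are disjoint (`±4` is not a shape-`B` coordinate). -/
theorem disjoint_setA_setB : Disjoint setA setB := by
  rw [Finset.disjoint_left]
  intro x hA hB
  obtain ⟨k, l, a, b, hkl, rfl⟩ := mem_setA.mp hA
  obtain ⟨o, v, _, h⟩ := mem_setB.mp hB
  have e := congrFun h k
  rw [avec_apply_left hkl] at e
  rcases sgn_cases a with ha | ha <;> rw [ha] at e <;>
    rcases bvec_apply_cases o v k with ⟨_, h1⟩ | ⟨_, h1 | h1⟩ <;> omega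

/-- `A` and `C` are disjoint (`±4` is not a shape-`C` coordinate). -/
theorem disjoint_setA_setC : Disjoint setA setC := by
  rw [Finset.disjoint_left]
  intro x hA hC
  obtain ⟨k, l, a, b, hkl, rfl⟩ := mem_setA.mp hA
  obtain ⟨i, u, _, h⟩ := mem_setC.mp hC
  have e := congrFun h k
  rw [avec_apply_left hkl] at e
  rcases sgn_cases a with ha | ha <;> rw [ha] at e <;>
    rcases cvec_apply_cases i u k with ⟨_, h1 | h1⟩ | ⟨_, h1 | h1⟩ <;> omega

/-- `B` and `C` are disjoint (even versus odd coordinates). -/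
theorem disjoint_setB_setC : Disjoint setB setC := by
  rw [Finset.disjoint_left]
  intro x hB hC
  obtain ⟨o, v, _, rfl⟩ := mem_setB.mp hB
  obtain ⟨i, u, _, h⟩ := mem_setC.mp hC
  have e := congrFun h i
  rcases bvec_apply_cases o v i with ⟨_, h0⟩ | ⟨_, h0 | h0⟩ <;> rw [h0] at e <;>
    rcases cvec_apply_cases i u i with ⟨_, h1 | h1⟩ | ⟨_, h1 | h1⟩ <;> omega

/-- **`|leechInt| = 196560`**, counted structurally: `1104 + 97152 + 98304`.
[cite: ConwaySloane1999, Ch. 4 §11 (135)] -/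
theorem card_leechInt : leechInt.card = 196560 := by
  rw [leechInt, card_union_eq_card_add_card.mpr, card_union_eq_card_add_card.mpr disjoint_setA_setB,
    card_setA, card_setB, card_setC]
  exact disjoint_union_left.mpr ⟨disjoint_setA_setC, disjoint_setB_setC⟩

/-- Shape trichotomy for members. -/
theorem mem_leechInt {x : Fin 24 → ℤ} (hx : x ∈ leechInt) :
    (∃ k l : Fin 24, ∃ a b : Bool, k < l ∧ x = avec k l a b) ∨ (∃ o : Fin 759, ∃ v < 128, x = bvec o v) ∨
      (∃ i : Fin 24, ∃ u < 4096, x = cvec i u) := by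
  rw [leechInt, mem_union, mem_union, mem_setA, mem_setB, mem_setC] at hx
  exact or_assoc.mp hx

/-- **Every Leech minimal vector has norm `32`.** [cite: ConwaySloane1999, Ch. 4 §11] -/
theorem ip_self_of_mem {x : Fin 24 → ℤ} (hx : x ∈ leechInt) : ip x x = 32 := by
  rcases mem_leechInt hx with ⟨k, l, a, b, hkl, rfl⟩ | ⟨o, v, _, rfl⟩ | ⟨i, u, _, rfl⟩
  · exact ip_avec_self hkl a b
  · exact ip_bvec_self o v
  · exact ip_cvec_self i u

/-- **Two distinct Leech minimal vectors have inner product `≤ 16`** (angle `≥ 60°`).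
[cite: ConwaySloane1999, Ch. 4 §11] -/
theorem ip_le_of_mem {x y : Fin 24 → ℤ} (hx : x ∈ leechInt) (hy : y ∈ leechInt) (hne : x ≠ y) :
    ip x y ≤ 16 := by
  rcases mem_leechInt hx with ⟨k, l, a, b, hkl, rfl⟩ | ⟨o, v, hv, rfl⟩ | ⟨i, u, hu, rfl⟩ <;>
    rcases mem_leechInt hy with ⟨k', l', a', b', hkl', rfl⟩ | ⟨o', v', hv', rfl⟩ | ⟨i', u', hu', rfl⟩
  · exact ip_avec_avec_le hkl hkl' hne
  · exact ip_avec_bvec_le hkl a b o' v'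
  · exact ip_avec_cvec_le hkl a b i' u'
  · rw [ip_comm]; exact ip_avec_bvec_le hkl' a' b' o v
  · by_cases hoo : o = o'
    · subst hoo; exact ip_bvec_bvec_same_le o hv hv' hne
    · exact ip_bvec_bvec_ne_le hoo v v'
  · exact ip_bvec_cvec_le o v i' hu'
  · rw [ip_comm]; exact ip_avec_cvec_le hkl' a' b' i u
  · rw [ip_comm]; exact ip_bvec_cvec_le o' v' i hu
  · exact ip_cvec_cvec_le hu hu' hne

end Summit.Ventures.PackingBounds.Config.Leech
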